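import Summits.CriticalPhenomena.PercolationContinuityZ3.Theorems.PercNearOneGluingNoHeavyLowerTailThreeRelayExchange
import HarnessLib

/-!
# `NoHeavyLowerTail` (stmt-CriticalPhenomena-4575) — the ANCHORED EXCHANGE: the three-relay exchange with the
# comparison hypothesis on the SPECTATOR instead of the block

Support file (lemma factory `prim-lf-3` gen 7, seat g9; `--supports stmt-CriticalPhenomena-4575`).  No definitions, no
named facts, no sorries.  Memo: `run/shared/lean/prim/prim-lf-3/LF3-BETA-R.md` §1, lemma (E) — the load-bearing lemma of
the proof of the `2+2` kernel (Kozma–Nitzan Question 9 for a depth-two observer with two two-port children, any core).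

Setting (`Fin n`, ranking weights `w`, block `S` glued: `glue_S w` = weight `1` on every non-loop pair inside `S`), `s₀ ∈ S`.
If the relay `v` is at most as connected to `b` as the spectator `a` IN THE UNGLUED GRAPH `w`, `μ_w(v ↔ b) ≤ μ_w(a ↔ b)`,
then after gluing `S`

  `μ_{glue_S w}(v ↔ b, s₀ ↮ b, a ↔ s₀) ≤ μ_{glue_S w}(s₀ ↔ b, v ↮ b, a ↮ v)`      (`anchoredExchange`).

Read as gains: when `v` is glued INTO the block `[S]`, the block gains `{v ↔ b, [S] ↮ b}` and the spectator `a` gains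
`{a ↮ b, a ↔ v, [S] ↔ b} ∪ {a ↮ b, a ↔ [S], v ↔ b}`; the lemma says `gain_{[S]} ≥ gain_a` whenever `v ≤ a` was true before
`S` was glued (compare `threeRelayExchange`: the same conclusion under `v ≤ s₀`).  It is FALSE if an unrelated set is glued
between the ranking and the exchange (memo §1, 16/1776 exact counterexamples), and it is exactly what makes "Lemma 5 for
gluing a two-atom unit into a relay" and the case analysis of the two-formal-unit inequality work (memo §3–4).
Proof: `UpsetExchange.upsetExchange_event` with anchor `a` and the event `E = {a ↔ s₀}` — on `E ∩ {S internally open}`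
every pair inside `S` lies in the open edge cluster of `a`, so the event is increasing in that cluster — gives
`μ_g(v ↔ b, a ↔ s₀) ≤ μ_g(a ↔ b, a ↔ s₀) = μ_g(s₀ ↔ b, a ↔ s₀)`; remove the common part `{v ↔ b, s₀ ↔ b, a ↔ s₀}` and use
`{s₀ ↔ b, a ↔ s₀, v ↮ b} ⊆ {s₀ ↔ b, v ↮ b, a ↮ v}`.
-/

namespace Summit.CriticalPhenomena.PercolationContinuityZ3.Theorems

open MeasureTheory Set ProbabilityTheory
open Literature.Probability.LatticeModels
open Literature.Probability.Percolation

noncomputable section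
open Classical

namespace UpsetExchange

variable {n : ℕ}

/-- **Anchored exchange.**  `s₀ ∈ S`, `μ_w(v ↔ b) ≤ μ_w(a ↔ b)` in the unglued graph; then in `glue_S w`,
`μ(v ↔ b ∩ (s₀ ↔ b)ᶜ ∩ a ↔ s₀) ≤ μ(s₀ ↔ b ∩ (v ↔ b)ᶜ ∩ (a ↔ v)ᶜ)`.
[cite: KozmaNitzan2024, Lemma 3(i) and Lemma 5 (pp. 6, 13); VandenbergHaggstromKahn2005, Thm. 1.2] -/
theorem anchoredExchange (w : Sym2 (Fin n) → unitInterval) (S : Finset (Fin n)) (v a b s₀ : Fin n)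
    (hs₀ : s₀ ∈ S)
    (hyp : (prodBernoulli w).real (openConn v b) ≤ (prodBernoulli w).real (openConn a b)) :
    (prodBernoulli (fun e : Sym2 (Fin n) => if (∀ x ∈ e, x ∈ S) ∧ ¬ e.IsDiag then 1 else w e)).real
        (openConn v b ∩ (openConn s₀ b)ᶜ ∩ openConn a s₀) ≤
      (prodBernoulli (fun e : Sym2 (Fin n) => if (∀ x ∈ e, x ∈ S) ∧ ¬ e.IsDiag then 1 else w e)).real
        (openConn s₀ b ∩ (openConn v b)ᶜ ∩ (openConn a v)ᶜ) := by
  set g : Sym2 (Fin n) → unitInterval := fun e => if (∀ x ∈ e, x ∈ S) ∧ ¬ e.IsDiag then 1 else w e with hg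
  -- the event `{a ↔ s₀}` is increasing in the open edge cluster of the ANCHOR `a`, jointly with `S` internally open
  set E : Set (BondConfig (Fin n)) := openConn a s₀ with hEdef
  have hE : ∀ ω ω' : BondConfig (Fin n), ω ∈ E →
      (∀ e : Sym2 (Fin n), (∀ x ∈ e, x ∈ S) → ¬ e.IsDiag → e ∈ ω) →
      openEdgeCluster ω a ⊆ openEdgeCluster ω' a →
      ω' ∈ E ∧ ∀ e : Sym2 (Fin n), (∀ x ∈ e, x ∈ S) → ¬ e.IsDiag → e ∈ ω' := by
    intro ω ω' hω hF hsub
    have key := mem_openEdgeCluster_of_open_mem S s₀ hs₀ ω hF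
    have has : (openGraph ω).Reachable a s₀ := hω
    -- the open edge clusters of `a` and `s₀` coincide on `E`
    have hclus : openEdgeCluster ω s₀ ⊆ openEdgeCluster ω a := by
      intro e he
      rw [mem_openEdgeCluster_iff] at he ⊢
      exact ⟨he.1, he.2.1, fun x hx => has.trans (he.2.2 x hx)⟩
    refine ⟨?_, fun e heS hed => ?_⟩
    · have has' : (openGraph ω').Reachable a s₀ := by
        rw [reachable_iff_exists_mem_openEdgeCluster] at has ⊢
        rcases has with h | ⟨e, he, hse⟩
        · exact Or.inl h
        · exact Or.inr ⟨e, hsub he, hse⟩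
      exact has'
    · have heω : e ∈ ω := hF e heS hed
      have hSne : ∃ x ∈ e, x ∈ S := by
        induction e using Sym2.ind with
        | h x y => exact ⟨x, Sym2.mem_mk_left x y, heS x (Sym2.mem_mk_left x y)⟩
      exact openEdgeCluster_subset ω' a (hsub (hclus (key.2 e heω hed hSne)))
  have hx := upsetExchange_event w S v b a E hE hyp
  -- on `E`, `a ↔ b` iff `s₀ ↔ b`
  have hab : openConn a b ∩ E = openConn s₀ b ∩ E := by
    ext ω
    simp only [hEdef, mem_inter_iff]
    constructor
    · rintro ⟨hab, has⟩
      exact ⟨((has : (openGraph ω).Reachable a s₀).symm).trans (hab : (openGraph ω).Reachable a b), has⟩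
    · rintro ⟨hsb, has⟩
      exact ⟨(has : (openGraph ω).Reachable a s₀).trans (hsb : (openGraph ω).Reachable s₀ b), has⟩
  rw [hab] at hx
  -- remove the common part `{v ↔ b} ∩ {s₀ ↔ b} ∩ {a ↔ s₀}` from both sides
  set Z : Set (BondConfig (Fin n)) := openConn v b ∩ openConn s₀ b ∩ E with hZ
  have hL : (prodBernoulli g).real (openConn v b ∩ (openConn s₀ b)ᶜ ∩ openConn a s₀) =
      (prodBernoulli g).real (openConn v b ∩ E) - (prodBernoulli g).real Z := by
    have hsplit := measureReal_inter_add_sdiff (μ := prodBernoulli g) (s := openConn v b ∩ E)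
      (MeasurableSet.of_discrete : MeasurableSet (openConn s₀ b : Set (BondConfig (Fin n)))) (measure_ne_top _ _)
    have h1 : openConn v b ∩ E ∩ openConn s₀ b = Z := by
      rw [hZ]; ext ω; simp only [mem_inter_iff]; tauto
    have h2 : (openConn v b ∩ E) \ openConn s₀ b = openConn v b ∩ (openConn s₀ b)ᶜ ∩ openConn a s₀ := by
      ext ω
      simp only [hEdef, mem_sdiff, mem_inter_iff, mem_compl_iff]
      tauto
    rw [h1, h2] at hsplit
    linarith
  have hR : (prodBernoulli g).real (openConn s₀ b ∩ E) - (prodBernoulli g).real Z ≤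
      (prodBernoulli g).real (openConn s₀ b ∩ (openConn v b)ᶜ ∩ (openConn a v)ᶜ) := by
    have hsplit := measureReal_inter_add_sdiff (μ := prodBernoulli g) (s := openConn s₀ b ∩ E)
      (MeasurableSet.of_discrete : MeasurableSet (openConn v b : Set (BondConfig (Fin n)))) (measure_ne_top _ _)
    have h1 : openConn s₀ b ∩ E ∩ openConn v b = Z := by
      rw [hZ]; ext ω; simp only [mem_inter_iff]; tauto
    have h2 : (prodBernoulli g).real ((openConn s₀ b ∩ E) \ openConn v b) ≤
        (prodBernoulli g).real (openConn s₀ b ∩ (openConn v b)ᶜ ∩ (openConn a v)ᶜ) := by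
      refine measureReal_mono ?_ (measure_ne_top _ _)
      rintro ω ⟨⟨hsb, has⟩, hvb⟩
      refine ⟨⟨hsb, hvb⟩, fun hav => hvb ?_⟩
      -- `a ↔ v` together with `a ↔ s₀`, `s₀ ↔ b` gives `v ↔ b`
      have has' : (openGraph ω).Reachable a s₀ := has
      have hav' : (openGraph ω).Reachable a v := hav
      have hsb' : (openGraph ω).Reachable s₀ b := hsb
      exact (hav'.symm.trans has').trans hsb'
    rw [h1] at hsplit
    linarith
  calc (prodBernoulli g).real (openConn v b ∩ (openConn s₀ b)ᶜ ∩ openConn a s₀)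
      = (prodBernoulli g).real (openConn v b ∩ E) - (prodBernoulli g).real Z := hL
    _ ≤ (prodBernoulli g).real (openConn s₀ b ∩ E) - (prodBernoulli g).real Z := by linarith
    _ ≤ (prodBernoulli g).real (openConn s₀ b ∩ (openConn v b)ᶜ ∩ (openConn a v)ᶜ) := hR

end UpsetExchange

end

end Summit.CriticalPhenomena.PercolationContinuityZ3.Theorems
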